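import Summits.AtomisticToContinuum.FouriersLaw.Theorems.JunctionLocalityNonBallisticOfSubcubicCorrector
import Summits.AtomisticToContinuum.FouriersLaw.Theorems.OddSectorIrreversibilityCorrectorTheoryExistence
import Summits.AtomisticToContinuum.FouriersLaw.Theorems.OddSectorIrreversibilityWitnessGlueTangent
import Summits.AtomisticToContinuum.FouriersLaw.Theorems.OddSectorIrreversibilityOddResponseBoundDensityUnique
import Summits.AtomisticToContinuum.FouriersLaw.Theorems.BondHeatUncertaintySubdiffusiveBondHeatKernelDetailedBalance

/-!
# Window–remainder bound on the response (crux `NonBallistic`, stmt-AtomisticToContinuum-9127)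

Helper file (`--supports stmt-AtomisticToContinuum-9127`, registered sub-goal `response_window_remainder_bound`) for the
corrector path to the crux `JunctionLocality.NonBallistic`. For the pinned anharmonic chain (all parameters `> 0`), `T > 0`,
`N ≥ 2`, a steady family with response coefficient `D = D_N` at `T` (the `δ`-limit of clause (ii), under weak-NESS uniqueness),
ANY a.e.-limit `u` of the finite-horizon Kubo correctors of the total current (the object of `ConeScaleCorrector` /
`CorrectorTheory`), and EVERY window `τ ≥ 0`:

  `(N-1) T² |D_N| ≤ ‖u_τ‖_π ‖J‖_π + ‖u‖_π ‖P_τ J‖_π`,   `u_τ = ∫_{(0,τ]} P_t J dt`,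

all norms in `L²` of the Gibbs probability measure `π = gibbsMeasure N T` (`‖u‖²_π = Z⁻¹ ∫ u² dμ_T`). Proof: corrector-form
Green–Kubo `(N-1)T²D_N = ⟨w, J⟩_π` for the explicit corrector `w = ∫₀^∞ P_sJ ds` (PROVED `CorrectorTheory` B + the pairing
lemma); the SHIFT IDENTITY `P_τ w = w - u_τ` (`corrector_exists`) splits `⟨w,J⟩ = ⟨u_τ,J⟩ + ⟨J, P_τ w⟩`; kernel DETAILED
BALANCE (`SubdiffusiveBondHeat.stub_kernelDetailedBalance`) with `J∘Θ = -J` gives `⟨J, P_τ w⟩ = -⟨w∘Θ, P_τ J⟩`; Cauchy–Schwarz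
twice, `Θ`-invariance of `π`, and `u = w` a.e. The two terms are the WINDOW (forecast of the time-integrated current up to `τ`:
`‖u_τ‖² = E[(E[Φ_τ | X_0])²] ≤ Var_π(Φ_τ)`) and the REMAINDER (full corrector against the DECAYED forecast `P_τ J`): `τ = 0` is
the one-Cauchy–Schwarz bound behind `nonBallistic_of_coneScaleCorrector`; `τ → ∞` kills the remainder at fixed `N`. So the crux
follows from ANY windows `τ_N` making the right-hand side `o(N²)` along a subsequence — a common roof over the corrector-size inputs
(E1 / SubcubicCorrector) and transit-window inputs (sub-ballistic FORECAST of `Φ_τ` plus decay of the total-current forecast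
`‖P_τ J‖`). No definitions; nothing here closes an item.
-/

noncomputable section

open MeasureTheory Filter Topology Set
open scoped BigOperators ENNReal NNReal

namespace Summit.AtomisticToContinuum.FouriersLaw.Theorems.NonBallistic

open Literature.MathematicalPhysics.KineticTheory.HeatConduction
open Literature.MathematicalPhysics.KineticTheory OscillatorChain
open Summit.AtomisticToContinuum.FouriersLaw.Theorems.SubdiffusiveBondHeat
open Summit.AtomisticToContinuum.FouriersLaw.Theorems.OddSectorIrreversibility.Corrector

/-- **Window–remainder bound** (registered sub-goal `response_window_remainder_bound`). For all admissible parameters,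
`T > 0`, `N ≥ 2`, under weak-NESS uniqueness, for every steady family with response coefficient `D` at `(N, T)`, every
a.e.-limit `u` of the finite-horizon Kubo correctors `∫_{(0,τ]} P_tJ dt` (w.r.t. `μ_T = e^{-H/T} dq dp`) and every window
`τ ≥ 0`: `(N-1) T² |D| ≤ √(∫ u_τ² dπ) √(∫ J² dπ) + √(∫ u² dπ) √(∫ (P_τJ)² dπ)`, `π = gibbsMeasure N T`. [folklore] -/
theorem response_window_remainder_bound :
    ∀ ω₂ lam β γ : ℝ, 0 < ω₂ → 0 < lam → 0 < β → 0 < γ →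
    (∀ (N : ℕ) (T_L T_R : ℝ), 0 < T_L → 0 < T_R → ∀ μ ν : Measure (PhaseSpace N),
      (pinnedChain ω₂ lam β γ).IsSteadyState N T_L T_R μ →
      (pinnedChain ω₂ lam β γ).IsSteadyState N T_L T_R ν → μ = ν) →
    ∀ μ : (N : ℕ) → ℝ → ℝ → Measure (PhaseSpace N),
      (∀ (N : ℕ) (T_L T_R : ℝ), 0 < T_L → 0 < T_R →
        (pinnedChain ω₂ lam β γ).IsSteadyState N T_L T_R (μ N T_L T_R)) →
    ∀ T : ℝ, 0 < T → ∀ N : ℕ, 2 ≤ N → ∀ D : ℝ,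
      Tendsto (fun δ : ℝ => (pinnedChain ω₂ lam β γ).totalCurrent (μ N (T + δ / 2) (T - δ / 2)) / δ)
        (nhdsWithin 0 {(0 : ℝ)}ᶜ) (nhds D) →
    ∀ u : PhaseSpace N → ℝ,
      (∀ᵐ x ∂(volume.withDensity fun x : PhaseSpace N => ENNReal.ofReal (Real.exp (-((pinnedChain ω₂ lam β γ).hamiltonian N x) / T))),
        Tendsto (fun τ : ℝ => (∫ t in Ioc (0 : ℝ) τ, (∫ y, (∑ i : Fin N, (pinnedChain ω₂ lam β γ).bondCurrent N i y) ∂((pinnedChain ω₂ lam β γ).transitionKernel N T T (Real.toNNReal t) x)))) atTop (𝓝 (u x))) →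
    ∀ τ : ℝ, 0 ≤ τ →
      ((N : ℝ) - 1) * T ^ 2 * |D| ≤
        Real.sqrt (∫ x, (∫ t in Ioc (0 : ℝ) τ, (∫ y, (∑ i : Fin N, (pinnedChain ω₂ lam β γ).bondCurrent N i y) ∂((pinnedChain ω₂ lam β γ).transitionKernel N T T (Real.toNNReal t) x))) ^ 2 ∂((pinnedChain ω₂ lam β γ).gibbsMeasure N T)) * Real.sqrt (∫ x, (∑ i : Fin N, (pinnedChain ω₂ lam β γ).bondCurrent N i x) ^ 2 ∂((pinnedChain ω₂ lam β γ).gibbsMeasure N T)) +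
        Real.sqrt (∫ x, (u x) ^ 2 ∂((pinnedChain ω₂ lam β γ).gibbsMeasure N T)) * Real.sqrt (∫ x, (∫ y, (∑ i : Fin N, (pinnedChain ω₂ lam β γ).bondCurrent N i y) ∂((pinnedChain ω₂ lam β γ).transitionKernel N T T (Real.toNNReal τ) x)) ^ 2 ∂((pinnedChain ω₂ lam β γ).gibbsMeasure N T)) := by
  intro ω₂ lam β γ hω hl hβ hγ huniq μf hμf T hT N hN D hD u hu τ hτ
  have hNpos : 0 < N := by omega
  have hN1 : 1 < N := by omega
  haveI : IsProbabilityMeasure ((pinnedChain ω₂ lam β γ).gibbsMeasure N T) := pinnedChain_isProbabilityMeasure_gibbsMeasure hω hl.le hβ.le γ N hT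
  -- Green–Kubo in corrector form (CorrectorTheory B)
  have hCT := Summit.AtomisticToContinuum.FouriersLaw.Theorems.OddSectorIrreversibility.Corrector.CorrectorTheory_proof
  obtain ⟨hcI, hGKB⟩ := hCT.2 ω₂ lam β γ hω hl hβ hγ huniq μf hμf T hT N D hD
  simp only [] at hcI hGKB
  -- the explicit corrector `w` and its shift identity
  have hϑ0 : (0 : ℝ) < 1 / T / 4 := by positivity
  have h2ϑ : 2 * (1 / T / 4) < 1 / T := by
    have : 0 < 1 / T := by positivity
    linarith
  obtain ⟨K, c, -, -, -, hwm, -, -, hwlim, hw2, hwL2, hshift⟩ :=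
    corrector_exists hω hl hβ hγ hT hNpos hϑ0 h2ϑ (fun s z => (∫ y, (∑ i : Fin N, (pinnedChain ω₂ lam β γ).bondCurrent N i y) ∂((pinnedChain ω₂ lam β γ).transitionKernel N T T (Real.toNNReal s) z))) rfl (fun z : PhaseSpace N => ∫ s in Ioi (0 : ℝ), (∫ y, (∑ i : Fin N, (pinnedChain ω₂ lam β γ).bondCurrent N i y) ∂((pinnedChain ω₂ lam β γ).transitionKernel N T T (Real.toNNReal s) z))) rfl
  -- `μ_T = Z • π`, `0 < Z < ∞`
  have hsm := Summit.AtomisticToContinuum.FouriersLaw.Theorems.pinnedChain_withDensity_eq_smul_gibbsMeasure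
    (γ := γ) (N := N) hω hl.le hT hβ.le
  have hZ0 : (pinnedChain ω₂ lam β γ).partitionFunction N T ≠ 0 :=
    (pinnedChain ω₂ lam β γ).partitionFunction_ne_zero (pinnedChain_continuous_gibbsDensity ω₂ lam β γ N T)
  have hZt : (pinnedChain ω₂ lam β γ).partitionFunction N T ≠ ⊤ :=
    (pinnedChain ω₂ lam β γ).partitionFunction_ne_top (pinnedChain_integrable_gibbsDensity hω hl.le hβ.le γ N hT)
  have hZpos : 0 < ((pinnedChain ω₂ lam β γ).partitionFunction N T).toReal := ENNReal.toReal_pos hZ0 hZt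
  -- transfer the `L²` facts about `w` from `μ_T` to `π`
  have hw2π : MemLp (fun z : PhaseSpace N => ∫ s in Ioi (0 : ℝ), (∫ y, (∑ i : Fin N, (pinnedChain ω₂ lam β γ).bondCurrent N i y) ∂((pinnedChain ω₂ lam β γ).transitionKernel N T T (Real.toNNReal s) z))) 2 ((pinnedChain ω₂ lam β γ).gibbsMeasure N T) := by
    have h := hw2.smul_measure (ENNReal.inv_ne_top.2 hZ0)
    rwa [hsm, smul_smul, ENNReal.inv_mul_cancel hZ0 hZt, one_smul] at h
  have hwL2π : Tendsto (fun σ : ℝ => ∫ x, ((∫ t in Ioc (0 : ℝ) σ, (∫ y, (∑ i : Fin N, (pinnedChain ω₂ lam β γ).bondCurrent N i y) ∂((pinnedChain ω₂ lam β γ).transitionKernel N T T (Real.toNNReal t) x))) - (fun z : PhaseSpace N => ∫ s in Ioi (0 : ℝ), (∫ y, (∑ i : Fin N, (pinnedChain ω₂ lam β γ).bondCurrent N i y) ∂((pinnedChain ω₂ lam β γ).transitionKernel N T T (Real.toNNReal s) z))) x) ^ 2 ∂((pinnedChain ω₂ lam β γ).gibbsMeasure N T)) atTop (𝓝 0) :=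 by
    have h : Tendsto (fun σ : ℝ => ((pinnedChain ω₂ lam β γ).partitionFunction N T).toReal⁻¹ *
        ∫ x, ((∫ t in Ioc (0 : ℝ) σ, (∫ y, (∑ i : Fin N, (pinnedChain ω₂ lam β γ).bondCurrent N i y) ∂((pinnedChain ω₂ lam β γ).transitionKernel N T T (Real.toNNReal t) x))) - (fun z : PhaseSpace N => ∫ s in Ioi (0 : ℝ), (∫ y, (∑ i : Fin N, (pinnedChain ω₂ lam β γ).bondCurrent N i y) ∂((pinnedChain ω₂ lam β γ).transitionKernel N T T (Real.toNNReal s) z))) x) ^ 2 ∂(volume.withDensity fun x : PhaseSpace N => ENNReal.ofReal (Real.exp (-((pinnedChain ω₂ lam β γ).hamiltonian N x) / T)))) atTop (𝓝 0) := by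
      simpa using hwL2.const_mul ((pinnedChain ω₂ lam β γ).partitionFunction N T).toReal⁻¹
    refine h.congr fun σ => ?_
    rw [hsm, integral_smul_measure, smul_eq_mul, ← mul_assoc, inv_mul_cancel₀ hZpos.ne', one_mul]
  -- `u = w` `π`-a.e. (`π ≪ μ_T`)
  have huwT : u =ᵐ[(volume.withDensity fun x : PhaseSpace N => ENNReal.ofReal (Real.exp (-((pinnedChain ω₂ lam β γ).hamiltonian N x) / T)))] (fun z : PhaseSpace N => ∫ s in Ioi (0 : ℝ), (∫ y, (∑ i : Fin N, (pinnedChain ω₂ lam β γ).bondCurrent N i y) ∂((pinnedChain ω₂ lam β γ).transitionKernel N T T (Real.toNNReal s) z))) := hu.mono fun z hz => tendsto_nhds_unique hz (hwlim z)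
  have hac : ((pinnedChain ω₂ lam β γ).gibbsMeasure N T) ≪ (volume.withDensity fun x : PhaseSpace N => ENNReal.ofReal (Real.exp (-((pinnedChain ω₂ lam β γ).hamiltonian N x) / T))) := by
    rw [hsm]; exact Measure.absolutelyContinuous_smul hZ0
  have huwπ : u =ᵐ[((pinnedChain ω₂ lam β γ).gibbsMeasure N T)] (fun z : PhaseSpace N => ∫ s in Ioi (0 : ℝ), (∫ y, (∑ i : Fin N, (pinnedChain ω₂ lam β γ).bondCurrent N i y) ∂((pinnedChain ω₂ lam β γ).transitionKernel N T T (Real.toNNReal s) z))) := hac.ae_eq huwT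
  -- `⟨w, J⟩_π = (N-1) T² D`
  have hwJ : ∫ x, (fun z : PhaseSpace N => ∫ s in Ioi (0 : ℝ), (∫ y, (∑ i : Fin N, (pinnedChain ω₂ lam β γ).bondCurrent N i y) ∂((pinnedChain ω₂ lam β γ).transitionKernel N T T (Real.toNNReal s) z))) x * (∑ i : Fin N, (pinnedChain ω₂ lam β γ).bondCurrent N i x) ∂((pinnedChain ω₂ lam β γ).gibbsMeasure N T) = ((N : ℝ) - 1) * T ^ 2 * D := by
    rw [hGKB]
    exact Summit.AtomisticToContinuum.FouriersLaw.Theorems.pinnedChain_integral_corrector_mul_gibbsMeasure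
      hω hl.le hβ hγ hNpos hT hw2π hwL2π hcI
  -- integrability on `π`
  have hwJi : Integrable (fun x => (fun z : PhaseSpace N => ∫ s in Ioi (0 : ℝ), (∫ y, (∑ i : Fin N, (pinnedChain ω₂ lam β γ).bondCurrent N i y) ∂((pinnedChain ω₂ lam β γ).transitionKernel N T T (Real.toNNReal s) z))) x * (∑ i : Fin N, (pinnedChain ω₂ lam β γ).bondCurrent N i x)) ((pinnedChain ω₂ lam β γ).gibbsMeasure N T) :=
    (Summit.AtomisticToContinuum.FouriersLaw.Theorems.pinnedChain_tendsto_integral_windowedCorrector_mul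
      hω hl.le hβ hγ hNpos hT hw2π hwL2π).1
  have hUJi : Integrable (fun x => (∫ t in Ioc (0 : ℝ) τ, (∫ y, (∑ i : Fin N, (pinnedChain ω₂ lam β γ).bondCurrent N i y) ∂((pinnedChain ω₂ lam β γ).transitionKernel N T T (Real.toNNReal t) x))) * (∑ i : Fin N, (pinnedChain ω₂ lam β γ).bondCurrent N i x)) ((pinnedChain ω₂ lam β γ).gibbsMeasure N T) :=
    (Summit.AtomisticToContinuum.FouriersLaw.Theorems.pinnedChain_integral_windowedCorrector_mul
      hω hl.le hβ hγ hNpos hT τ).1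
  have hU2 : Integrable (fun x => (∫ t in Ioc (0 : ℝ) τ, (∫ y, (∑ i : Fin N, (pinnedChain ω₂ lam β γ).bondCurrent N i y) ∂((pinnedChain ω₂ lam β γ).transitionKernel N T T (Real.toNNReal t) x))) ^ 2) ((pinnedChain ω₂ lam β γ).gibbsMeasure N T) :=
    (Summit.AtomisticToContinuum.FouriersLaw.Theorems.pinnedChain_sq_windowedCorrector_le hω hl.le hβ hγ hNpos hT hτ).1
  obtain ⟨hJ2, hPJ2, -⟩ :=
    Summit.AtomisticToContinuum.FouriersLaw.Theorems.pinnedChain_sq_act_sum_bondCurrent hω hl.le hβ hγ hNpos hT τ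
  -- measurability
  have hJc : Continuous fun z : PhaseSpace N => (∑ i : Fin N, (pinnedChain ω₂ lam β γ).bondCurrent N i z) :=
    Summit.AtomisticToContinuum.FouriersLaw.Theorems.pinnedChain_continuous_sum_bondCurrent
  have hJm : Measurable fun z : PhaseSpace N => (∑ i : Fin N, (pinnedChain ω₂ lam β γ).bondCurrent N i z) := hJc.measurable
  have hPJτm : StronglyMeasurable fun x : PhaseSpace N =>
      (∫ y, (∑ i : Fin N, (pinnedChain ω₂ lam β γ).bondCurrent N i y) ∂((pinnedChain ω₂ lam β γ).transitionKernel N T T (Real.toNNReal τ) x)) :=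
    hJc.stronglyMeasurable.integral_kernel (κ := (pinnedChain ω₂ lam β γ).transitionKernel N T T (Real.toNNReal τ))
  have hPJm : StronglyMeasurable fun p : PhaseSpace N × ℝ =>
      (∫ y, (∑ i : Fin N, (pinnedChain ω₂ lam β γ).bondCurrent N i y) ∂((pinnedChain ω₂ lam β γ).transitionKernel N T T (Real.toNNReal p.2) p.1)) :=
    Summit.AtomisticToContinuum.FouriersLaw.Theorems.pinnedChain_stronglyMeasurable_act_sum_bondCurrent hω hl.le hβ hγ
  have hUm : AEStronglyMeasurable (fun x : PhaseSpace N => (∫ t in Ioc (0 : ℝ) τ,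
      (∫ y, (∑ i : Fin N, (pinnedChain ω₂ lam β γ).bondCurrent N i y) ∂((pinnedChain ω₂ lam β γ).transitionKernel N T T (Real.toNNReal t) x))))
      ((pinnedChain ω₂ lam β γ).gibbsMeasure N T) :=
    (hPJm.integral_prod_right' (ν := volume.restrict (Ioc (0 : ℝ) τ))).aestronglyMeasurable
  have hwmeas : Measurable (fun z : PhaseSpace N => ∫ s in Ioi (0 : ℝ),
      (∫ y, (∑ i : Fin N, (pinnedChain ω₂ lam β γ).bondCurrent N i y) ∂((pinnedChain ω₂ lam β γ).transitionKernel N T T (Real.toNNReal s) z))) :=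
    hwm.measurable
  -- the window split `w = u_τ + P_τ w` (shift identity) under the pairing with `J`
  have hKi : Integrable (fun x => (∑ i : Fin N, (pinnedChain ω₂ lam β γ).bondCurrent N i x) * (∫ y, (∫ s in Ioi (0 : ℝ), (∫ y, (∑ i : Fin N, (pinnedChain ω₂ lam β γ).bondCurrent N i y) ∂((pinnedChain ω₂ lam β γ).transitionKernel N T T (Real.toNNReal s) y))) ∂((pinnedChain ω₂ lam β γ).transitionKernel N T T (Real.toNNReal τ) x))) ((pinnedChain ω₂ lam β γ).gibbsMeasure N T) := by
    refine (hwJi.sub hUJi).congr (Eventually.of_forall fun x => ?_)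
    have hs := hshift τ hτ x
    simp only [Pi.sub_apply]
    rw [hs]; ring
  have hsplit : ∫ x, (fun z : PhaseSpace N => ∫ s in Ioi (0 : ℝ), (∫ y, (∑ i : Fin N, (pinnedChain ω₂ lam β γ).bondCurrent N i y) ∂((pinnedChain ω₂ lam β γ).transitionKernel N T T (Real.toNNReal s) z))) x * (∑ i : Fin N, (pinnedChain ω₂ lam β γ).bondCurrent N i x) ∂((pinnedChain ω₂ lam β γ).gibbsMeasure N T) =
      (∫ x, (∫ t in Ioc (0 : ℝ) τ, (∫ y, (∑ i : Fin N, (pinnedChain ω₂ lam β γ).bondCurrent N i y) ∂((pinnedChain ω₂ lam β γ).transitionKernel N T T (Real.toNNReal t) x))) * (∑ i : Fin N, (pinnedChain ω₂ lam β γ).bondCurrent N i x) ∂((pinnedChain ω₂ lam β γ).gibbsMeasure N T)) + ∫ x, (∑ i : Fin N, (pinnedChain ω₂ lam β γ).bondCurrent N i x) * (∫ y, (∫ s in Ioi (0 : ℝ), (∫ y, (∑ i : Fin N, (pinnedChain ω₂ lam β γ).bondCurrent N i y) ∂((pinnedChain ω₂ lam β γ).transitionKernel N T T (Real.toNNReal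 s) y))) ∂((pinnedChain ω₂ lam β γ).transitionKernel N T T (Real.toNNReal τ) x)) ∂((pinnedChain ω₂ lam β γ).gibbsMeasure N T) := by
    rw [← integral_add hUJi hKi]
    refine integral_congr_ae (Eventually.of_forall fun x => ?_)
    have hs := hshift τ hτ x
    simp only []
    rw [hs]; ring
  -- detailed balance: `⟨J, P_τ w⟩ = -⟨w∘Θ, P_τ J⟩`
  have hw2sq : Integrable (fun y => (fun z : PhaseSpace N => ∫ s in Ioi (0 : ℝ), (∫ y, (∑ i : Fin N, (pinnedChain ω₂ lam β γ).bondCurrent N i y) ∂((pinnedChain ω₂ lam β γ).transitionKernel N T T (Real.toNNReal s) z))) y ^ 2) ((pinnedChain ω₂ lam β γ).gibbsMeasure N T) := hw2π.integrable_sq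
  have hDB := stub_kernelDetailedBalance ω₂ lam β γ hω hl hβ hγ T hT N hN1 (Real.toNNReal τ)
    (fun z : PhaseSpace N => (∑ i : Fin N, (pinnedChain ω₂ lam β γ).bondCurrent N i z)) (fun z : PhaseSpace N => ∫ s in Ioi (0 : ℝ), (∫ y, (∑ i : Fin N, (pinnedChain ω₂ lam β γ).bondCurrent N i y) ∂((pinnedChain ω₂ lam β γ).transitionKernel N T T (Real.toNNReal s) z))) hJm hwmeas hJ2 hw2sq
  have hJodd : ∀ y : PhaseSpace N, (∑ i : Fin N, (pinnedChain ω₂ lam β γ).bondCurrent N i (y.1, -y.2)) = -(∑ i : Fin N, (pinnedChain ω₂ lam β γ).bondCurrent N i y) := by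
    intro y
    rw [← Finset.sum_neg_distrib]
    exact Finset.sum_congr rfl fun i _ => (pinnedChain ω₂ lam β γ).bondCurrent_neg_momentum N i y
  have hDB' : ∫ x, (∑ i : Fin N, (pinnedChain ω₂ lam β γ).bondCurrent N i x) * (∫ y, (∫ s in Ioi (0 : ℝ), (∫ y, (∑ i : Fin N, (pinnedChain ω₂ lam β γ).bondCurrent N i y) ∂((pinnedChain ω₂ lam β γ).transitionKernel N T T (Real.toNNReal s) y))) ∂((pinnedChain ω₂ lam β γ).transitionKernel N T T (Real.toNNReal τ) x)) ∂((pinnedChain ω₂ lam β γ).gibbsMeasure N T) =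
      -∫ x, (fun z : PhaseSpace N => ∫ s in Ioi (0 : ℝ), (∫ y, (∑ i : Fin N, (pinnedChain ω₂ lam β γ).bondCurrent N i y) ∂((pinnedChain ω₂ lam β γ).transitionKernel N T T (Real.toNNReal s) z))) (x.1, -x.2) * (∫ y, (∑ i : Fin N, (pinnedChain ω₂ lam β γ).bondCurrent N i y) ∂((pinnedChain ω₂ lam β γ).transitionKernel N T T (Real.toNNReal τ) x)) ∂((pinnedChain ω₂ lam β γ).gibbsMeasure N T) := by
    rw [hDB, ← integral_neg]
    refine integral_congr_ae (Eventually.of_forall fun x => ?_)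
    have hflip : (∫ y', (∑ i : Fin N, (pinnedChain ω₂ lam β γ).bondCurrent N i (y'.1, -y'.2))
        ∂((pinnedChain ω₂ lam β γ).transitionKernel N T T (Real.toNNReal τ) x)) = -(∫ y, (∑ i : Fin N, (pinnedChain ω₂ lam β γ).bondCurrent N i y) ∂((pinnedChain ω₂ lam β γ).transitionKernel N T T (Real.toNNReal τ) x)) := by
      simp only [hJodd, integral_neg]
    simp only []
    rw [hflip]; ring
  -- Cauchy–Schwarz for the window term
  have hUmem : MemLp (fun x : PhaseSpace N => (∫ t in Ioc (0 : ℝ) τ, (∫ y, (∑ i : Fin N, (pinnedChain ω₂ lam β γ).bondCurrent N i y) ∂((pinnedChain ω₂ lam β γ).transitionKernel N T T (Real.toNNReal t) x)))) 2 ((pinnedChain ω₂ lam β γ).gibbsMeasure N T) :=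
    (memLp_two_iff_integrable_sq hUm).2 hU2
  have hJmem : MemLp (fun z : PhaseSpace N => (∑ i : Fin N, (pinnedChain ω₂ lam β γ).bondCurrent N i z)) 2 ((pinnedChain ω₂ lam β γ).gibbsMeasure N T) :=
    (memLp_two_iff_integrable_sq hJc.aestronglyMeasurable).2 hJ2
  have hA : |∫ x, (∫ t in Ioc (0 : ℝ) τ, (∫ y, (∑ i : Fin N, (pinnedChain ω₂ lam β γ).bondCurrent N i y) ∂((pinnedChain ω₂ lam β γ).transitionKernel N T T (Real.toNNReal t) x))) * (∑ i : Fin N, (pinnedChain ω₂ lam β γ).bondCurrent N i x) ∂((pinnedChain ω₂ lam β γ).gibbsMeasure N T)| ≤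
      Real.sqrt (∫ x, (∫ t in Ioc (0 : ℝ) τ, (∫ y, (∑ i : Fin N, (pinnedChain ω₂ lam β γ).bondCurrent N i y) ∂((pinnedChain ω₂ lam β γ).transitionKernel N T T (Real.toNNReal t) x))) ^ 2 ∂((pinnedChain ω₂ lam β γ).gibbsMeasure N T)) * Real.sqrt (∫ x, (∑ i : Fin N, (pinnedChain ω₂ lam β γ).bondCurrent N i x) ^ 2 ∂((pinnedChain ω₂ lam β γ).gibbsMeasure N T)) :=
    OddSectorWitness.abs_integral_mul_le_sqrt hUmem hJmem
  -- Cauchy–Schwarz for the remainder term, `Θ`-invariance of `π`, `u = w` a.e.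
  have hΘ : MeasurePreserving (momentumReversal N) ((pinnedChain ω₂ lam β γ).gibbsMeasure N T) ((pinnedChain ω₂ lam β γ).gibbsMeasure N T) :=
    OddResponseBound.DensityUnique.measurePreserving_momentumReversal_gibbsMeasure (pinnedChain ω₂ lam β γ) N T
  have hwΘmem : MemLp (fun x : PhaseSpace N => (fun z : PhaseSpace N => ∫ s in Ioi (0 : ℝ), (∫ y, (∑ i : Fin N, (pinnedChain ω₂ lam β γ).bondCurrent N i y) ∂((pinnedChain ω₂ lam β γ).transitionKernel N T T (Real.toNNReal s) z))) (x.1, -x.2)) 2 ((pinnedChain ω₂ lam β γ).gibbsMeasure N T) := by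
    have := hw2π.comp_measurePreserving hΘ
    simpa [Function.comp_def, momentumReversal_apply] using this
  have hPJmem : MemLp (fun x : PhaseSpace N => (∫ y, (∑ i : Fin N, (pinnedChain ω₂ lam β γ).bondCurrent N i y) ∂((pinnedChain ω₂ lam β γ).transitionKernel N T T (Real.toNNReal τ) x))) 2 ((pinnedChain ω₂ lam β γ).gibbsMeasure N T) :=
    (memLp_two_iff_integrable_sq hPJτm.aestronglyMeasurable).2 hPJ2
  have hB0 : |∫ x, (fun z : PhaseSpace N => ∫ s in Ioi (0 : ℝ), (∫ y, (∑ i : Fin N, (pinnedChain ω₂ lam β γ).bondCurrent N i y) ∂((pinnedChain ω₂ lam β γ).transitionKernel N T T (Real.toNNReal s) z))) (x.1, -x.2) * (∫ y, (∑ i : Fin N, (pinnedChain ω₂ lam β γ).bondCurrent N i y) ∂((pinnedChain ω₂ lam β γ).transitionKernel N T T (Real.toNNReal τ) x)) ∂((pinnedChain ω₂ lam β γ).gibbsMeasure N T)| ≤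
      Real.sqrt (∫ x, ((fun z : PhaseSpace N => ∫ s in Ioi (0 : ℝ), (∫ y, (∑ i : Fin N, (pinnedChain ω₂ lam β γ).bondCurrent N i y) ∂((pinnedChain ω₂ lam β γ).transitionKernel N T T (Real.toNNReal s) z))) (x.1, -x.2)) ^ 2 ∂((pinnedChain ω₂ lam β γ).gibbsMeasure N T)) * Real.sqrt (∫ x, (∫ y, (∑ i : Fin N, (pinnedChain ω₂ lam β γ).bondCurrent N i y) ∂((pinnedChain ω₂ lam β γ).transitionKernel N T T (Real.toNNReal τ) x)) ^ 2 ∂((pinnedChain ω₂ lam β γ).gibbsMeasure N T)) :=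
    OddSectorWitness.abs_integral_mul_le_sqrt hwΘmem hPJmem
  have hwΘint : ∫ x, ((fun z : PhaseSpace N => ∫ s in Ioi (0 : ℝ), (∫ y, (∑ i : Fin N, (pinnedChain ω₂ lam β γ).bondCurrent N i y) ∂((pinnedChain ω₂ lam β γ).transitionKernel N T T (Real.toNNReal s) z))) (x.1, -x.2)) ^ 2 ∂((pinnedChain ω₂ lam β γ).gibbsMeasure N T) = ∫ x, (u x) ^ 2 ∂((pinnedChain ω₂ lam β γ).gibbsMeasure N T) := by
    have h1 : ∫ x, ((fun z : PhaseSpace N => ∫ s in Ioi (0 : ℝ), (∫ y, (∑ i : Fin N, (pinnedChain ω₂ lam β γ).bondCurrent N i y) ∂((pinnedChain ω₂ lam β γ).transitionKernel N T T (Real.toNNReal s) z))) (x.1, -x.2)) ^ 2 ∂((pinnedChain ω₂ lam β γ).gibbsMeasure N T) = ∫ x, ((fun z : PhaseSpace N => ∫ s in Ioi (0 : ℝ), (∫ y, (∑ i : Fin N, (pinnedChain ω₂ lam β γ).bondCurrent N i y) ∂((pinnedChain ω₂ lam β γ).transitionKernel N T T (Real.toNNReal s) z))) x) ^ 2 ∂((pinnedChain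 ω₂ lam β γ).gibbsMeasure N T) := by
      have := hΘ.integral_comp (momentumReversal N).measurableEmbedding (fun y => (fun z : PhaseSpace N => ∫ s in Ioi (0 : ℝ), (∫ y, (∑ i : Fin N, (pinnedChain ω₂ lam β γ).bondCurrent N i y) ∂((pinnedChain ω₂ lam β γ).transitionKernel N T T (Real.toNNReal s) z))) y ^ 2)
      simpa [momentumReversal_apply] using this
    rw [h1]
    exact integral_congr_ae (huwπ.mono fun x hx => by simp only []; rw [hx])
  -- assemble
  have hkey : ((N : ℝ) - 1) * T ^ 2 * D =
      (∫ x, (∫ t in Ioc (0 : ℝ) τ, (∫ y, (∑ i : Fin N, (pinnedChain ω₂ lam β γ).bondCurrent N i y) ∂((pinnedChain ω₂ lam β γ).transitionKernel N T T (Real.toNNReal t) x))) * (∑ i : Fin N, (pinnedChain ω₂ lam β γ).bondCurrent N i x) ∂((pinnedChain ω₂ lam β γ).gibbsMeasure N T)) - ∫ x, (fun z : PhaseSpace N => ∫ s in Ioi (0 : ℝ), (∫ y, (∑ i : Fin N, (pinnedChain ω₂ lam β γ).bondCurrent N i y) ∂((pinnedChain ω₂ lam β γ).transitionKernel N T T (Real.toNNReal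 s) z))) (x.1, -x.2) * (∫ y, (∑ i : Fin N, (pinnedChain ω₂ lam β γ).bondCurrent N i y) ∂((pinnedChain ω₂ lam β γ).transitionKernel N T T (Real.toNNReal τ) x)) ∂((pinnedChain ω₂ lam β γ).gibbsMeasure N T) := by
    rw [← hwJ, hsplit, hDB']; ring
  have hfac : 0 ≤ ((N : ℝ) - 1) * T ^ 2 := by
    have h2 : (2 : ℝ) ≤ N := by exact_mod_cast hN
    have : 0 ≤ (N : ℝ) - 1 := by linarith
    positivity
  calc ((N : ℝ) - 1) * T ^ 2 * |D| = |((N : ℝ) - 1) * T ^ 2 * D| := by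
        rw [abs_mul, abs_of_nonneg hfac]
    _ = |(∫ x, (∫ t in Ioc (0 : ℝ) τ, (∫ y, (∑ i : Fin N, (pinnedChain ω₂ lam β γ).bondCurrent N i y) ∂((pinnedChain ω₂ lam β γ).transitionKernel N T T (Real.toNNReal t) x))) * (∑ i : Fin N, (pinnedChain ω₂ lam β γ).bondCurrent N i x) ∂((pinnedChain ω₂ lam β γ).gibbsMeasure N T)) - ∫ x, (fun z : PhaseSpace N => ∫ s in Ioi (0 : ℝ), (∫ y, (∑ i : Fin N, (pinnedChain ω₂ lam β γ).bondCurrent N i y) ∂((pinnedChain ω₂ lam β γ).transitionKernel N T T (Real.toNNReal s) z))) (x.1, -x.2) * (∫ y, (∑ i : Fin N, (pinnedChain ω₂ lam β γ).bondCurrent N i y) ∂((pinnedChain ω₂ lam β γ).transitionKernel N T T (Real.toNNReal τ) x)) ∂((pinnedChain ω₂ lam β γ).gibbsMeasure N T)| := by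
        rw [hkey]
    _ ≤ |∫ x, (∫ t in Ioc (0 : ℝ) τ, (∫ y, (∑ i : Fin N, (pinnedChain ω₂ lam β γ).bondCurrent N i y) ∂((pinnedChain ω₂ lam β γ).transitionKernel N T T (Real.toNNReal t) x))) * (∑ i : Fin N, (pinnedChain ω₂ lam β γ).bondCurrent N i x) ∂((pinnedChain ω₂ lam β γ).gibbsMeasure N T)| + |∫ x, (fun z : PhaseSpace N => ∫ s in Ioi (0 : ℝ), (∫ y, (∑ i : Fin N, (pinnedChain ω₂ lam β γ).bondCurrent N i y) ∂((pinnedChain ω₂ lam β γ).transitionKernel N T T (Real.toNNReal s) z))) (x.1, -x.2) * (∫ y, (∑ i : Fin N, (pinnedChain ω₂ lam β γ).bondCurrent N i y) ∂((pinnedChain ω₂ lam β γ).transitionKernel N T T (Real.toNNReal τ) x)) ∂((pinnedChain ω₂ lam β γ).gibbsMeasure N T)| :=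
        abs_sub _ _
    _ ≤ Real.sqrt (∫ x, (∫ t in Ioc (0 : ℝ) τ, (∫ y, (∑ i : Fin N, (pinnedChain ω₂ lam β γ).bondCurrent N i y) ∂((pinnedChain ω₂ lam β γ).transitionKernel N T T (Real.toNNReal t) x))) ^ 2 ∂((pinnedChain ω₂ lam β γ).gibbsMeasure N T)) * Real.sqrt (∫ x, (∑ i : Fin N, (pinnedChain ω₂ lam β γ).bondCurrent N i x) ^ 2 ∂((pinnedChain ω₂ lam β γ).gibbsMeasure N T)) +
          Real.sqrt (∫ x, (u x) ^ 2 ∂((pinnedChain ω₂ lam β γ).gibbsMeasure N T)) * Real.sqrt (∫ x, (∫ y, (∑ i : Fin N, (pinnedChain ω₂ lam β γ).bondCurrent N i y) ∂((pinnedChain ω₂ lam β γ).transitionKernel N T T (Real.toNNReal τ) x)) ^ 2 ∂((pinnedChain ω₂ lam β γ).gibbsMeasure N T)) := by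
        rw [← hwΘint]; exact add_le_add hA hB0


/-- **`WindowRemainderSmall → NonBallistic`** (registered sub-goal `nonBallistic_of_windowRemainderSmall`): if beyond every
`N₀` some length `N` and some window `τ ≥ 0` make the window–remainder bound `≤ ε N²` for every a.e.-limit corrector `u`
(there is one, by the PROVED `CorrectorTheory` A), then `D_N ≤ ε'(N-1)` beyond every `N₀` — the crux
`JunctionLocality.NonBallistic`. The hypothesis is the common roof over the corrector-size inputs (`τ = 0`: one Cauchy–Schwarz,
`ConeScaleCorrector` / SubcubicCorrector) and window inputs (sub-ballistic FORECAST `‖u_τ‖` of the integrated current plus decay of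
the total-current forecast `‖P_τ J‖`); it is open (FALSE for the harmonic member, like the crux). [folklore] -/
theorem nonBallistic_of_windowRemainderSmall :
    (∀ ω₂ lam β γ : ℝ, 0 < ω₂ → 0 < lam → 0 < β → 0 < γ → ∀ T : ℝ, 0 < T → ∀ ε : ℝ, 0 < ε → ∀ N₀ : ℕ,
      ∃ N : ℕ, N₀ ≤ N ∧ ∃ τ : ℝ, 0 ≤ τ ∧ ∀ u : PhaseSpace N → ℝ,
        (∀ᵐ x ∂(volume.withDensity fun x : PhaseSpace N => ENNReal.ofReal (Real.exp (-((pinnedChain ω₂ lam β γ).hamiltonian N x) / T))),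
          Tendsto (fun τ : ℝ => (∫ t in Ioc (0 : ℝ) τ, (∫ y, (∑ i : Fin N, (pinnedChain ω₂ lam β γ).bondCurrent N i y) ∂((pinnedChain ω₂ lam β γ).transitionKernel N T T (Real.toNNReal t) x)))) atTop (𝓝 (u x))) →
        Real.sqrt (∫ x, (∫ t in Ioc (0 : ℝ) τ, (∫ y, (∑ i : Fin N, (pinnedChain ω₂ lam β γ).bondCurrent N i y) ∂((pinnedChain ω₂ lam β γ).transitionKernel N T T (Real.toNNReal t) x))) ^ 2 ∂((pinnedChain ω₂ lam β γ).gibbsMeasure N T)) * Real.sqrt (∫ x, (∑ i : Fin N, (pinnedChain ω₂ lam β γ).bondCurrent N i x) ^ 2 ∂((pinnedChain ω₂ lam β γ).gibbsMeasure N T)) +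
          Real.sqrt (∫ x, (u x) ^ 2 ∂((pinnedChain ω₂ lam β γ).gibbsMeasure N T)) * Real.sqrt (∫ x, (∫ y, (∑ i : Fin N, (pinnedChain ω₂ lam β γ).bondCurrent N i y) ∂((pinnedChain ω₂ lam β γ).transitionKernel N T T (Real.toNNReal τ) x)) ^ 2 ∂((pinnedChain ω₂ lam β γ).gibbsMeasure N T)) ≤
        ε * (N : ℝ) ^ 2) →
      Summit.AtomisticToContinuum.FouriersLaw.Theses.JunctionLocality.NonBallistic := by
  intro hW ω₂ lam β γ hω hl hβ hγ huniq μf hμf T hT D hD ε hε N₀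
  have hT2 : 0 < T ^ 2 := by positivity
  -- the roof at tolerance `ε T²/4`, beyond `max N₀ 2`
  obtain ⟨N, hNge, τ, hτ, hWN⟩ := hW ω₂ lam β γ hω hl hβ hγ T hT (ε * T ^ 2 / 4) (by positivity) (max N₀ 2)
  have hNN₀ : N₀ ≤ N := le_trans (le_max_left _ _) hNge
  have hN2 : 2 ≤ N := le_trans (le_max_right _ _) hNge
  refine ⟨N, hNN₀, ?_⟩
  -- a corrector at `N` (CorrectorTheory A) and the window–remainder bound for it
  have hCT := Summit.AtomisticToContinuum.FouriersLaw.Theorems.OddSectorIrreversibility.Corrector.CorrectorTheory_proof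
  obtain ⟨u, -, -, hu3, -⟩ := hCT.1 ω₂ lam β γ hω hl hβ hγ T hT N
  simp only [] at hu3
  have hbound := response_window_remainder_bound ω₂ lam β γ hω hl hβ hγ huniq μf hμf T hT N hN2 (D N) (hD N) u hu3 τ hτ
  have hroof := hWN u hu3
  -- arithmetic
  set n : ℝ := (N : ℝ) with hndef
  have hn2 : (2 : ℝ) ≤ n := by rw [hndef]; exact_mod_cast hN2
  have hn1 : 0 < n - 1 := by linarith
  have hnsq : n ^ 2 ≤ 4 * (n - 1) ^ 2 := by nlinarith
  have h1 : (n - 1) * T ^ 2 * |D N| ≤ ε * T ^ 2 / 4 * n ^ 2 := hbound.trans hroof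
  have h2 : (n - 1) * T ^ 2 * D N ≤ (n - 1) * T ^ 2 * (ε * (n - 1)) := by
    have hpos : 0 ≤ (n - 1) * T ^ 2 := by positivity
    calc (n - 1) * T ^ 2 * D N ≤ (n - 1) * T ^ 2 * |D N| :=
          mul_le_mul_of_nonneg_left (le_abs_self _) hpos
      _ ≤ ε * T ^ 2 / 4 * n ^ 2 := h1
      _ ≤ ε * T ^ 2 / 4 * (4 * (n - 1) ^ 2) := by
          have : 0 ≤ ε * T ^ 2 / 4 := by positivity
          exact mul_le_mul_of_nonneg_left hnsq this
      _ = (n - 1) * T ^ 2 * (ε * (n - 1)) := by ring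
  exact le_of_mul_le_mul_left h2 (by positivity)

end Summit.AtomisticToContinuum.FouriersLaw.Theorems.NonBallistic

end
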